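import Mathlib.CategoryTheory.Sites.PreservesSheafification
import Mathlib.CategoryTheory.Sites.LocallyInjective
import Mathlib.CategoryTheory.Sites.LeftExact
import Mathlib.CategoryTheory.Sites.Whiskering
import Mathlib.CategoryTheory.Sites.Spaces
import Mathlib.Algebra.Category.ModuleCat.Limits
import Mathlib.Algebra.Category.ModuleCat.Colimits
import Mathlib.Algebra.Category.ModuleCat.FilteredColimits
import Literature.AlgebraicGeometry.HodgeTheory.ClassesSupportedOn
import Literature.AlgebraicGeometry.Motives.VarietiesProperProofs
import Literature.AlgebraicGeometry.Motives.VarietiesGeometricallyIntegralProofs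
import HarnessLib

/-!
# Bloch–Ogus sheaves `𝓗^q_X(A)` and unramified cohomology `H^q_nr(X, A)`

For a scheme `X` over `ℂ`, a coefficient ring `A` (e.g. `ℤ`, `ℤ/m`, `ℚ`, `ℂ`) and a degree `q`,
on the tree's real carriers (`ComplexPoints X = X(ℂ)` with its strong topology,
`complexPointsCompl X Z = (X ∖ Z)(ℂ) ⊆ X(ℂ)`, `singularCohomology A A – q`):

* `bettiZariskiPresheaf A X q` — the presheaf of `A`-modules on the ZARISKI topology of `X`,
  `U ↦ H^q(U(ℂ); A)` with `U(ℂ) := complexPointsCompl X (↑U)ᶜ = {P ∈ X(ℂ) | P.pt ∈ U}`, restriction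
  = pull-back along the inclusions `V(ℂ) ↪ U(ℂ)` (Bloch–Ogus 1974, §4, the presheaf `U ↦ Hⁱ(U, n)`
  of Example (2.3); Colliot-Thélène–Voisin 2012, Déf. 2.1);
* `blochOgusSheaf A X q` — its sheafification `𝓗^q_X(A)` for the Zariski topology (Mathlib's
  `presheafToSheaf` on the site `Opens X`; Bloch–Ogus 1974, §4; CT–Voisin 2012, Déf. 2.1:
  `𝓗ⁱ_X(A) := Rⁱπ_* A`, "le faisceau Zariski associé au préfaisceau `U ↦ Hⁱ(U(ℂ), A)`");
* `unramifiedCohomology A X q` — the **unramified cohomology** `H^q_nr(X, A) := H⁰(X_Zar, 𝓗^q_X(A))`,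
  the global sections of `𝓗^q_X(A)` (CT–Voisin 2012, Déf. 2.2);
* `unramifiedClass A X q : H^q(X(ℂ); A) ⟶ H^q_nr(X, A)` — the canonical map (sheafification on
  global sections), whose value on `z` is the **unramified class** of `z`;
* `coniveauFiltration A X q r = Nʳ H^q(X(ℂ); A)` — Grothendieck's coniveau filtration with
  `A`-coefficients, `Σ_Z ker (H^q(X(ℂ); A) → H^q((X ∖ Z)(ℂ); A))` over Zariski-closed `Z` all of whose
  points have codimension `≥ r` (Bloch–Ogus 1974, (0) and (3.8)); DEFINITIONALLY the tree's
  `HodgeTheory.supportedClasses X q r` for `A = ℂ` and `Motives.coniveau X q r` for `A = ℚ`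
  (`coniveauFiltration_complex`, `coniveauFiltration_rat`, both `rfl`).

## Main results (all proved, except the one named fact)

* `unramifiedClass_eq_zero_iff` — `z ↦ 0 ∈ H^q_nr(X, A)` iff `z` is ZARISKI-LOCALLY zero: every
  scheme point has a Zariski neighbourhood `U` with `z|_{U(ℂ)} = 0` (sheafification is locally
  injective and a sheaf is separated; no hypothesis on `X`).
* `ker_unramifiedClass_le_coniveauFiltration_one` — for `X` irreducible,
  `ker (H^q(X(ℂ); A) → H^q_nr(X, A)) ≤ N¹ H^q` (a Zariski-locally zero class dies on a non-empty open,
  whose closed complement misses the generic point, hence has codimension `≥ 1` pointwise).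
* `BlochOgus1974_blochOgusSheaf_injective` — NAMED FACT (Bloch–Ogus 1974, Thm. 4.2 (4.2.2) for the
  Poincaré duality theory of Example (2.3)): for `X` smooth, separated, of finite type and
  irreducible over `ℂ`, the Zariski sheaf map `𝓗^q_X(A) → i_{η*} H^q(ℂ(X); A)` is injective, in the
  elementary stalkwise form "a class on `U(ℂ)` that dies on a non-empty open `W ⊆ U` dies Zariski-
  locally on `U`".
* `coniveauFiltration_one_eq_ker_unramifiedClass` — granted that fact, the comparison
  `N¹ H^q(X(ℂ); A) = ker (H^q(X(ℂ); A) → H^q_nr(X, A))` (Bloch–Ogus 1974, (3.8)–(3.9) with (6.3): the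
  edge map of the coniveau spectral sequence), and its unfoldings `mem_coniveauFiltration_iff_exists`,
  `unramifiedClass_eq_zero_iff_exists` in the `∃ Z closed, Z ≠ X, z|_{(X ∖ Z)(ℂ)} = 0` shape used by
  route statements.

## Design notes

* `U(ℂ)` is `complexPointsCompl X (↑U)ᶜ`, literally `{P : X(ℂ) // P.pt ∉ (↑U)ᶜ}`, so that for a closed
  `Z` the route-side carrier `complexPointsCompl X Z` and the presheaf carrier over the open `Zᶜ`
  are related by the tree's `HodgeTheory.complexPointsComplInclusion` (`Z ⊆ Zᶜᶜ` and `Zᶜᶜ ⊆ Z`);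
  `restrictToOpen A X q U` is by definition `restrictToCompl A X q (↑U)ᶜ`.
* Values in `ModuleCat.{0} A`; the site `Opens X.left` is small, so Mathlib synthesises
  `HasSheafify`, `HasSheafCompose (forget _)` and `PreservesSheafification (forget _)` for it, which
  give `Presheaf.IsLocallyInjective (toSheafify _ _)` and `Sheaf.isSeparated`.
* `H⁰(X_Zar, 𝓗)` is taken to be the module of global sections `𝓗(X)` (equal to the degree-`0` sheaf
  cohomology; the tree's `cohomologyPresheafZeroEquiv` records `H'⁰(U, F) ≃+ F(U)` for Mathlib's `Ext`
  definition), which is what CT–Voisin's `H⁰(X, 𝓗ⁱ_X(A))` denotes.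
* Mathlib has no unramified cohomology, Bloch–Ogus theory or coniveau filtration (searched
  `unramified`, `BlochOgus`, `coniveau`, `Gersten`: only (formally) unramified MORPHISMS); the tree had
  the coniveau filtration for `ℚ` and `ℂ` coefficients only.
* `H^q_nr(X, A)` is NOT the generic stalk `H^q(ℂ(X); A) = colim_{U ≠ ∅} H^q(U(ℂ); A)`: by the same
  Bloch–Ogus injectivity it EMBEDS into it (CT–Voisin 2012, Thm. 2.8 (ii): `Hⁱ_nr(X, A) ⊂ Hⁱ_B(ℂ(X), A)`)
  as the subgroup of classes unramified along every divisor, in general a proper subgroup; on the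
  image of `H^q(X(ℂ); A)` both targets see the same kernel `N¹ H^q` (Bloch–Ogus (3.8)). The generic
  stalk `functionFieldCohomology A X q`, the restriction `toFunctionField` and the PROVED kernel
  statement `ker_toFunctionField_eq_coniveauFiltration_one` (Bloch–Ogus (3.8)) live in the companion
  file `Motives/FunctionFieldCohomology`.
* NOT here: the residue maps, the Gersten (arithmetic) resolution (4.2.2) beyond its first map, the
  coniveau spectral sequence, the identification with étale cohomology for torsion coefficients
  (CT–Voisin 2012, §2.2), and Bloch–Kato consequences (CT–Voisin 2012, Thm. 3.1: `𝓗^q_X(ℤ)`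
  torsion-free) — separate requests.

## References

* [BlochOgus1974ENS] S. Bloch, A. Ogus, *Gersten's conjecture and the homology of schemes*, Ann.
  Sci. ÉNS (4) 7 (1974) 181–201: Introduction (definition of `Nᵖ Hⁱ`), Example (2.3) (singular
  cohomology of `X_an` with any coefficient ring), (3.8) (coniveau filtration as a kernel), §4
  (the Zariski sheaves `𝓗^q`), Thm. 4.2 (exactness of the arithmetic resolution (4.2.2)), Cor. 6.3.
* [ColliotTheleneVoisin2012] J.-L. Colliot-Thélène, C. Voisin, *Cohomologie non ramifiée et
  conjecture de Hodge entière*, Duke Math. J. 161 (2012), Déf. 2.1 (`𝓗ⁱ_X(A)`), Déf. 2.2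
  (`Hⁱ_nr(X, A) = H⁰(X, 𝓗ⁱ_X(A))`), Thm. 2.3 (Bloch–Ogus resolution for Betti cohomology).
* [GrothendieckTopology1969] A. Grothendieck, *Hodge's general conjecture is false for trivial
  reasons*, Topology 8 (1969), §1 (the filtration by codimension of support).
-/

noncomputable section

open CategoryTheory AlgebraicGeometry Opposite TopologicalSpace
open Literature.AlgebraicTopology.SingularHomology

namespace Literature.AlgebraicGeometry.Motives

universe u

variable (A : Type) [CommRing A] (X : SchemeOver ℂ) (q : ℕ)

/-! ### Restriction to open complements, and the Zariski presheaf `U ↦ H^q(U(ℂ); A)` -/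

/-- Restriction `H^q(X(ℂ); A) ⟶ H^q((X ∖ Z)(ℂ); A)` to the complex points over the complement of a
subset `Z ⊆ X`, for an arbitrary coefficient ring `A` (the tree's `bettiCohomology.restrictCompl`,
`complexBetti.restrictCompl` are the cases `A = ℚ, ℂ`): pull-back along `(X ∖ Z)(ℂ) ↪ X(ℂ)`.
[cite: GrothendieckTopology1969, §1] -/
abbrev restrictToCompl (Z : Set X.left) :
    singularCohomology A A (ComplexPoints X) q ⟶
      singularCohomology A A (complexPointsCompl X Z) q :=
  singularCohomology.map A A
    (⟨Subtype.val, continuous_subtype_val⟩ : C(complexPointsCompl X Z, ComplexPoints X)) q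

/-- Restriction `H^q(X(ℂ); A) ⟶ H^q(U(ℂ); A)` to the complex points `U(ℂ) = {P ∈ X(ℂ) | P.pt ∈ U}`
over a Zariski open `U ⊆ X`, realised as `restrictToCompl A X q (↑U)ᶜ`.
[cite: BlochOgus1974ENS, §4 (restriction maps of the presheaf U ↦ H(U))] -/
abbrev restrictToOpen (U : X.left.Opens) :
    singularCohomology A A (ComplexPoints X) q ⟶
      singularCohomology A A (complexPointsCompl X ((U : Set X.left)ᶜ)) q :=
  restrictToCompl A X q ((U : Set X.left)ᶜ)

variable {X} in
/-- The inclusion `U(ℂ) ↪ V(ℂ)` of complex points over Zariski opens `U ≤ V` (an instance of the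
tree's `HodgeTheory.complexPointsComplInclusion`, as `(↑V)ᶜ ⊆ (↑U)ᶜ`). [folklore] -/
abbrev complexPointsOpenInclusion {U V : X.left.Opens} (h : U ≤ V) :
    C(complexPointsCompl X ((U : Set X.left)ᶜ), complexPointsCompl X ((V : Set X.left)ᶜ)) :=
  HodgeTheory.complexPointsComplInclusion (Set.compl_subset_compl.2 (SetLike.coe_subset_coe.2 h))

/-- The **Zariski presheaf of Betti cohomology** `U ↦ H^q(U(ℂ); A)` on the opens of `X`, with
restriction maps the pull-backs along `V(ℂ) ↪ U(ℂ)` for `V ≤ U` (Bloch–Ogus 1974, §4, for the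
theory `H*(X_an; A)` of Example (2.3); Colliot-Thélène–Voisin 2012, Déf. 2.1).
[cite: BlochOgus1974ENS, §4 and Example (2.3)] -/
abbrev bettiZariskiPresheaf : (X.left.Opens)ᵒᵖ ⥤ ModuleCat.{0} A :=
  { obj := fun U ↦ singularCohomology A A (complexPointsCompl X ((U.unop : Set X.left)ᶜ)) q
    map := fun i ↦ singularCohomology.map A A (complexPointsOpenInclusion i.unop.le) q
    map_id := fun U ↦ by
      have h : complexPointsOpenInclusion (le_refl U.unop) = ContinuousMap.id _ :=
        ContinuousMap.ext fun _ ↦ rfl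
      change singularCohomology.map A A (complexPointsOpenInclusion (le_refl U.unop)) q = _
      rw [h, singularCohomology.map_id]
    map_comp := fun f g ↦
      singularCohomology.map_comp A A (complexPointsOpenInclusion g.unop.le)
        (complexPointsOpenInclusion f.unop.le) q }

/-- Unfolding: the sections of `bettiZariskiPresheaf` over `U` are `H^q(U(ℂ); A)`.
[cite: BlochOgus1974ENS, §4] -/
theorem bettiZariskiPresheaf_obj (U : (X.left.Opens)ᵒᵖ) :
    (bettiZariskiPresheaf A X q).obj U =
      singularCohomology A A (complexPointsCompl X ((U.unop : Set X.left)ᶜ)) q :=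
  rfl

/-- Unfolding: the restriction maps of `bettiZariskiPresheaf` are pull-backs along the inclusions
of complex points. [cite: BlochOgus1974ENS, §4] -/
theorem bettiZariskiPresheaf_map {U V : (X.left.Opens)ᵒᵖ} (i : U ⟶ V) :
    (bettiZariskiPresheaf A X q).map i =
      singularCohomology.map A A (complexPointsOpenInclusion i.unop.le) q :=
  rfl

/-- Restriction to `U(ℂ)` followed by restriction to `V(ℂ)`, `V ≤ U`, is restriction to `V(ℂ)`
(functoriality of `H^q`). [folklore] -/
theorem restrictToOpen_comp_map {U V : X.left.Opens} (i : V ⟶ U) :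
    restrictToOpen A X q U ≫ (bettiZariskiPresheaf A X q).map i.op = restrictToOpen A X q V :=
  (singularCohomology.map_comp A A (complexPointsOpenInclusion i.le)
    (⟨Subtype.val, continuous_subtype_val⟩ :
      C(complexPointsCompl X ((U : Set X.left)ᶜ), ComplexPoints X)) q).symm

/-- Elementwise form of `restrictToOpen_comp_map`: `(z|_{U(ℂ)})|_{V(ℂ)} = z|_{V(ℂ)}`. [folklore] -/
theorem map_restrictToOpen_apply {U V : X.left.Opens} (i : V ⟶ U)
    (z : singularCohomology A A (ComplexPoints X) q) :
    (bettiZariskiPresheaf A X q).map i.op (restrictToOpen A X q U z) =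
      restrictToOpen A X q V z := by
  rw [← restrictToOpen_comp_map A X q i, ModuleCat.comp_apply]

/-- A class dying off `Z` dies off every larger `Z' ⊇ Z` (restriction to `(X ∖ Z')(ℂ)` factors
through `(X ∖ Z)(ℂ)`). [cite: GrothendieckTopology1969, §1] -/
theorem restrictToCompl_eq_zero_of_subset {Z Z' : Set X.left} (h : Z ⊆ Z')
    {z : singularCohomology A A (ComplexPoints X) q} (hz : restrictToCompl A X q Z z = 0) :
    restrictToCompl A X q Z' z = 0 := by
  have hc : restrictToCompl A X q Z' =
      restrictToCompl A X q Z ≫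
        singularCohomology.map A A (HodgeTheory.complexPointsComplInclusion h) q :=
    singularCohomology.map_comp A A (HodgeTheory.complexPointsComplInclusion h)
      (⟨Subtype.val, continuous_subtype_val⟩ : C(complexPointsCompl X Z, ComplexPoints X)) q
  rw [hc, ModuleCat.comp_apply, hz, map_zero]

/-! ### The Bloch–Ogus sheaf and unramified cohomology -/

/-- The **Bloch–Ogus sheaf** `𝓗^q_X(A)`: the sheaf of `A`-modules for the ZARISKI topology of `X`
associated to the presheaf `U ↦ H^q(U(ℂ); A)` (Bloch–Ogus 1974, §4: "define sheaves `𝓗^q(n)` for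
the Zariski topology on `X` by sheafifying the presheaves `U ↦ H^q(U, n)`"; Colliot-Thélène–Voisin
2012, Déf. 2.1: `𝓗ⁱ_X(A) := Rⁱπ_* A`, equivalently this sheafification).
[cite: ColliotTheleneVoisin2012, Déf. 2.1] [cite: BlochOgus1974ENS, §4] -/
abbrev blochOgusSheaf : Sheaf (Opens.grothendieckTopology X.left) (ModuleCat.{0} A) :=
  (presheafToSheaf (Opens.grothendieckTopology X.left) (ModuleCat.{0} A)).obj
    (bettiZariskiPresheaf A X q)

/-- The **unramified cohomology** `H^q_nr(X, A) := H⁰(X_Zar, 𝓗^q_X(A))` of `X` with coefficients in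
`A`: the `A`-module of global sections of the Bloch–Ogus sheaf (Colliot-Thélène–Voisin 2012,
Déf. 2.2). [cite: ColliotTheleneVoisin2012, Déf. 2.2] -/
abbrev unramifiedCohomology : ModuleCat.{0} A :=
  (blochOgusSheaf A X q).obj.obj (op ⊤)

/-- The sheafification map on sections over a Zariski open `U`:
`H^q(U(ℂ); A) ⟶ 𝓗^q_X(A)(U)`. [cite: ColliotTheleneVoisin2012, Déf. 2.1] -/
abbrev toBlochOgusSheaf (U : X.left.Opens) :
    (bettiZariskiPresheaf A X q).obj (op U) ⟶ (blochOgusSheaf A X q).obj.obj (op U) :=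
  (toSheafify (Opens.grothendieckTopology X.left) (bettiZariskiPresheaf A X q)).app (op U)

/-- The **unramified class** map `H^q(X(ℂ); A) ⟶ H^q_nr(X, A)`: restrict to `X(ℂ) = ⊤(ℂ)` and
sheafify (the edge map `H^q(X) → H⁰(X, 𝓗^q) = E₂^{0,q}` of Bloch–Ogus 1974, (6.3)–(6.4); the map
`Hⁱ(X(ℂ), A) → Hⁱ_nr(X, A)` of Colliot-Thélène–Voisin 2012, Thm. 2.8 (ii)).
[cite: ColliotTheleneVoisin2012, Thm. 2.8 (ii)] -/
def unramifiedClass : singularCohomology A A (ComplexPoints X) q ⟶ unramifiedCohomology A X q :=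
  restrictToOpen A X q ⊤ ≫ toBlochOgusSheaf A X q ⊤

/-- Unfolding of `unramifiedClass`. [cite: ColliotTheleneVoisin2012, Thm. 2.8 (ii)] -/
theorem unramifiedClass_apply (z : singularCohomology A A (ComplexPoints X) q) :
    unramifiedClass A X q z = toBlochOgusSheaf A X q ⊤ (restrictToOpen A X q ⊤ z) :=
  rfl

/-- Naturality of sheafification: restricting a sheafified section is sheafifying the restricted
section. [folklore] -/
theorem map_toBlochOgusSheaf_apply {U V : X.left.Opens} (i : V ⟶ U)
    (a : (bettiZariskiPresheaf A X q).obj (op U)) :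
    (blochOgusSheaf A X q).obj.map i.op (toBlochOgusSheaf A X q U a) =
      toBlochOgusSheaf A X q V ((bettiZariskiPresheaf A X q).map i.op a) :=
  (NatTrans.naturality_apply (toSheafify (Opens.grothendieckTopology X.left)
    (bettiZariskiPresheaf A X q)) i.op a).symm

/-- **Kernel of the unramified class map = Zariski-locally trivial classes.** A class
`z ∈ H^q(X(ℂ); A)` has unramified class `0` iff every scheme point of `X` has a Zariski open
neighbourhood `U` with `z|_{U(ℂ)} = 0` (the sheafification map is locally injective, and sections
of a sheaf that vanish on a covering vanish). [cite: ColliotTheleneVoisin2012, Déf. 2.1–2.2] -/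
theorem unramifiedClass_eq_zero_iff (z : singularCohomology A A (ComplexPoints X) q) :
    unramifiedClass A X q z = 0 ↔
      ∀ x : X.left, ∃ U : X.left.Opens, x ∈ U ∧ restrictToOpen A X q U z = 0 := by
  constructor
  · intro hz x
    have h0 : toBlochOgusSheaf A X q ⊤ (restrictToOpen A X q ⊤ z) = toBlochOgusSheaf A X q ⊤ 0 := by
      rw [map_zero]
      exact hz
    have hmem := Presheaf.equalizerSieve_mem (Opens.grothendieckTopology X.left)
      (toSheafify (Opens.grothendieckTopology X.left) (bettiZariskiPresheaf A X q)) _ _ h0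
    rw [Opens.mem_grothendieckTopology] at hmem
    obtain ⟨U, f, hf, hxU⟩ := hmem x trivial
    refine ⟨U, hxU, ?_⟩
    have hf' : (bettiZariskiPresheaf A X q).map f.op (restrictToOpen A X q ⊤ z) =
        (bettiZariskiPresheaf A X q).map f.op 0 := hf
    rwa [map_zero, map_restrictToOpen_apply] at hf'
  · intro h
    refine Sheaf.isSeparated (blochOgusSheaf A X q) ⊤
      (Presheaf.equalizerSieve (restrictToOpen A X q ⊤ z)
        (0 : (bettiZariskiPresheaf A X q).obj (op ⊤))) ?_ _ _ ?_
    · rw [Opens.mem_grothendieckTopology]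
      intro x _
      obtain ⟨U, hxU, hU⟩ := h x
      refine ⟨U, homOfLE le_top, ?_, hxU⟩
      change (bettiZariskiPresheaf A X q).map (homOfLE (le_top : U ≤ ⊤)).op
          (restrictToOpen A X q ⊤ z) =
        (bettiZariskiPresheaf A X q).map (homOfLE (le_top : U ≤ ⊤)).op 0
      rw [map_zero, map_restrictToOpen_apply]
      exact hU
    · intro V f hf
      have hf' : (bettiZariskiPresheaf A X q).map f.op (restrictToOpen A X q ⊤ z) =
          (bettiZariskiPresheaf A X q).map f.op 0 := hf
      rw [map_zero] at hf'
      rw [map_zero, unramifiedClass_apply, map_toBlochOgusSheaf_apply, hf', map_zero]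

/-! ### The coniveau filtration with arbitrary coefficients -/

/-- The **coniveau filtration** `Nʳ H^q(X(ℂ); A) ⊆ H^q(X(ℂ); A)` with coefficients in `A`: the sum,
over Zariski-closed `Z ⊆ X` all of whose points have codimension `≥ r` (`r ≤ Order.coheight z`, the
codimension of a scheme point in the specialisation order), of `ker (H^q(X(ℂ); A) → H^q((X ∖ Z)(ℂ); A))`
(Bloch–Ogus 1974, Introduction and (3.8): `Nᵖ Hⁱ(X) = ⋃ ker {Hⁱ(X) → Hⁱ(X − Z)}`, `Z` closed of
codimension `≥ p`; Grothendieck 1969, §1). Verbatim the tree's `Motives.coniveau` (`A = ℚ`) and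
`HodgeTheory.supportedClasses` (`A = ℂ`). [cite: BlochOgus1974ENS, Introduction and (3.8)] -/
def coniveauFiltration (r : ℕ) : Submodule A (singularCohomology A A (ComplexPoints X) q) :=
  ⨆ (Z : Set X.left) (_ : IsClosed Z) (_ : ∀ z ∈ Z, (r : ℕ∞) ≤ Order.coheight z),
    LinearMap.ker (restrictToCompl A X q Z).hom

/-- `coniveauFiltration ℂ` is DEFINITIONALLY the tree's `Nʳ H^q(X(ℂ); ℂ) = supportedClasses X q r`.
[cite: GrothendieckTopology1969, §1] -/
theorem coniveauFiltration_complex (r : ℕ) :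
    coniveauFiltration ℂ X q r = HodgeTheory.supportedClasses X q r :=
  rfl

/-- `coniveauFiltration ℚ` is DEFINITIONALLY the tree's `Nʳ H^q_B(X) = coniveau X q r`.
[cite: GrothendieckTopology1969, §1] -/
theorem coniveauFiltration_rat (r : ℕ) : coniveauFiltration ℚ X q r = coniveau X q r :=
  rfl

variable {X} in
/-- A class killed by restriction to the complement of a closed `Z` of codimension `≥ r` lies in
`Nʳ H^q(X(ℂ); A)` (the defining generators). [cite: BlochOgus1974ENS, (3.8)] -/
theorem mem_coniveauFiltration_of_restrictToCompl_eq_zero {r : ℕ} {Z : Set X.left}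
    (hZ : IsClosed Z) (hr : ∀ z ∈ Z, (r : ℕ∞) ≤ Order.coheight z)
    {z : singularCohomology A A (ComplexPoints X) q} (hz : restrictToCompl A X q Z z = 0) :
    z ∈ coniveauFiltration A X q r :=
  Submodule.mem_iSup_of_mem Z (Submodule.mem_iSup_of_mem hZ (Submodule.mem_iSup_of_mem hr hz))

/-- The coniveau filtration is decreasing: `Nˢ ⊆ Nʳ` for `r ≤ s`. [cite: BlochOgus1974ENS, (3.8)] -/
theorem coniveauFiltration_mono {r s : ℕ} (h : r ≤ s) :
    coniveauFiltration A X q s ≤ coniveauFiltration A X q r := by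
  refine iSup_mono fun Z ↦ iSup_mono fun _ ↦ iSup_le fun hs ↦ le_iSup_of_le (fun z hz ↦ ?_) le_rfl
  exact le_trans (by exact_mod_cast h) (hs z hz)

/-- `N⁰ H^q(X(ℂ); A)` is everything: take `Z = X`, whose complement has no complex points (sanity
check that the filtration is not trivially small). [cite: BlochOgus1974ENS, (3.8)] -/
theorem coniveauFiltration_zero : coniveauFiltration A X q 0 = ⊤ := by
  refine eq_top_iff.2 fun x _ ↦ mem_coniveauFiltration_of_restrictToCompl_eq_zero A q
    isClosed_univ (fun _ _ ↦ by simp) ?_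
  haveI : IsEmpty (complexPointsCompl X Set.univ) := ⟨fun P ↦ P.2 (Set.mem_univ _)⟩
  haveI := ModuleCat.subsingleton_of_isZero
    (isZero_singularCohomology_of_isEmpty A A (E := complexPointsCompl X Set.univ) q)
  exact Subsingleton.elim _ _

variable {X} in
/-- `Nʳ H^q(X(ℂ); A)` membership, unfolded: a class lies in the coniveau filtration iff it dies off
ONE Zariski-closed subset all of whose points have codimension `≥ r` (finite unions of such subsets
are again such, so the generating kernels form a directed family). [cite: BlochOgus1974ENS, (3.8)] -/
theorem mem_coniveauFiltration_iff_exists {r : ℕ} {z : singularCohomology A A (ComplexPoints X) q} :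
    z ∈ coniveauFiltration A X q r ↔ ∃ Z : Set X.left, IsClosed Z ∧
      (∀ y ∈ Z, (r : ℕ∞) ≤ Order.coheight y) ∧ restrictToCompl A X q Z z = 0 := by
  refine ⟨fun hz ↦ ?_, fun ⟨_, hZ, hr, h0⟩ ↦
    mem_coniveauFiltration_of_restrictToCompl_eq_zero A q hZ hr h0⟩
  let S : Submodule A (singularCohomology A A (ComplexPoints X) q) :=
    { carrier := {x | ∃ Z : Set X.left, IsClosed Z ∧ (∀ y ∈ Z, (r : ℕ∞) ≤ Order.coheight y) ∧
        restrictToCompl A X q Z x = 0}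
      zero_mem' := ⟨∅, isClosed_empty, fun y hy ↦ (Set.notMem_empty y hy).elim, map_zero _⟩
      add_mem' := by
        rintro a b ⟨Z, hZ, hrZ, ha⟩ ⟨W, hW, hrW, hb⟩
        refine ⟨Z ∪ W, hZ.union hW, ?_, ?_⟩
        · rintro y (hy | hy)
          exacts [hrZ y hy, hrW y hy]
        · rw [map_add, restrictToCompl_eq_zero_of_subset A X q Set.subset_union_left ha,
            restrictToCompl_eq_zero_of_subset A X q Set.subset_union_right hb, add_zero]
      smul_mem' := by
        rintro c a ⟨Z, hZ, hrZ, ha⟩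
        exact ⟨Z, hZ, hrZ, by rw [map_smul, ha, smul_zero]⟩ }
  have h : coniveauFiltration A X q r ≤ S :=
    iSup_le fun Z ↦ iSup_le fun hZ ↦ iSup_le fun hrZ y hy ↦ ⟨Z, hZ, hrZ, hy⟩
  exact h hz

/-! ### Generic points and codimension `≥ 1` -/

/-- The generic point of an irreducible scheme is maximal in the specialisation order
(`a ≤ b ↔ b ⤳ a` on a scheme; the generic point specialises to every point). [folklore] -/
theorem isMax_genericPoint (Y : Scheme.{u}) [IrreducibleSpace Y] : IsMax (genericPoint Y) :=
  fun b _ ↦ Scheme.le_iff_specializes.2 (genericPoint_specializes b)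

/-- The generic point of an irreducible scheme has codimension `0`. [folklore] -/
theorem coheight_genericPoint (Y : Scheme.{u}) [IrreducibleSpace Y] :
    Order.coheight (genericPoint Y) = 0 :=
  Order.coheight_eq_zero.2 (isMax_genericPoint Y)

/-- In an irreducible scheme every point of a proper closed subset has codimension `≥ 1`: a point
of codimension `0` is maximal, hence specialised to only by points it specialises to, so the
generic point would lie in the closed set, which would then be everything. [folklore] -/
theorem one_le_coheight_of_mem_of_ne_univ {Y : Scheme.{u}} [IrreducibleSpace Y] {Z : Set Y}
    (hZ : IsClosed Z) (hZne : Z ≠ Set.univ) {z : Y} (hz : z ∈ Z) :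
    ((1 : ℕ) : ℕ∞) ≤ Order.coheight z := by
  rw [Nat.cast_one, Order.one_le_iff_pos, Order.coheight_pos]
  intro hmax
  have h1 : z ≤ genericPoint Y := Scheme.le_iff_specializes.2 (genericPoint_specializes z)
  have h2 : z ⤳ genericPoint Y := Scheme.le_iff_specializes.1 (hmax h1)
  have h3 : genericPoint Y ∈ Z := h2.mem_closed hZ hz
  have h4 : closure {genericPoint Y} ⊆ Z := hZ.closure_subset_iff.2 (Set.singleton_subset_iff.2 h3)
  rw [genericPoint_closure] at h4
  exact hZne (Set.eq_univ_of_univ_subset h4)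

/-- A closed subset of an irreducible scheme all of whose points have codimension `≥ 1` misses
the generic point. [folklore] -/
theorem genericPoint_notMem_of_forall_one_le_coheight {Y : Scheme.{u}} [IrreducibleSpace Y]
    {Z : Set Y} (hr : ∀ z ∈ Z, ((1 : ℕ) : ℕ∞) ≤ Order.coheight z) : genericPoint Y ∉ Z := by
  intro h
  have h1 := hr _ h
  rw [coheight_genericPoint] at h1
  exact absurd h1 (by simp)

/-- For a closed subset `Z` of an irreducible scheme, "every point of `Z` has codimension `≥ 1`"
iff `Z ≠ X`. [folklore] -/
theorem forall_one_le_coheight_iff_ne_univ {Y : Scheme.{u}} [IrreducibleSpace Y] {Z : Set Y}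
    (hZ : IsClosed Z) : (∀ z ∈ Z, ((1 : ℕ) : ℕ∞) ≤ Order.coheight z) ↔ Z ≠ Set.univ :=
  ⟨fun h hZu ↦ genericPoint_notMem_of_forall_one_le_coheight h (hZu ▸ Set.mem_univ _),
    fun h _ hz ↦ one_le_coheight_of_mem_of_ne_univ hZ h hz⟩

/-! ### The comparison `N¹ H^q = ker (H^q(X(ℂ); A) → H^q_nr(X, A))` -/

/-- **Easy half of the comparison** (no smoothness): on an irreducible `X`, a class with unramified
class `0` lies in `N¹ H^q(X(ℂ); A)` — it dies on a Zariski neighbourhood `U` of the generic point,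
and the closed complement of the non-empty open `U` has codimension `≥ 1` pointwise.
[cite: BlochOgus1974ENS, (3.8)] -/
theorem ker_unramifiedClass_le_coniveauFiltration_one [IrreducibleSpace X.left] :
    LinearMap.ker (unramifiedClass A X q).hom ≤ coniveauFiltration A X q 1 := by
  intro z hz
  obtain ⟨U, hxU, hU⟩ := (unramifiedClass_eq_zero_iff A X q z).1 hz (genericPoint X.left)
  refine mem_coniveauFiltration_of_restrictToCompl_eq_zero A q U.isOpen.isClosed_compl
    (fun y hy ↦ one_le_coheight_of_mem_of_ne_univ U.isOpen.isClosed_compl ?_ hy) hU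
  intro hU'
  have : genericPoint X.left ∈ ((U : Set X.left)ᶜ) := hU' ▸ Set.mem_univ _
  exact this hxU

/-- **Bloch–Ogus injectivity `𝓗^q_X(A) ↪ i_{η*} H^q(ℂ(X); A)`** (named fact). For `X` smooth,
separated and of finite type over `ℂ` and irreducible with generic point `η`, the first map of the
arithmetic (Gersten) resolution
`0 → 𝓗^q → i_{η*} H^q(ℂ(X)) → ⊕_{x ∈ X⁽¹⁾} i_{x*} H^{q-1}(ℂ(x)) → ⋯` is injective — Bloch–Ogus 1974,
Thm. 4.2 (4.2.2) ("the complex of sheaves `0 → 𝓗^q(n) → ⊕_{x ∈ Z⁰/Z¹} i_x H^q(x, n) → ⋯` is exact",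
`k` perfect, `X` smooth over `k`, any Poincaré duality theory with supports), applied to the theory
`H*(X) = H*(X_an; A)` of their Example (2.3) ("`k = ℂ` … of course one can take any ring of
coefficients in place of `ℤ`"); restated for Betti cohomology as Colliot-Thélène–Voisin 2012,
Thm. 2.3. Here `H^q(η) = colim_{W ≠ ∅} H^q(W(ℂ); A)` (Bloch–Ogus (3.9)), so injectivity ON STALKS at a
point `x` reads, elementarily: a class `α ∈ H^q(U(ℂ); A)` on a Zariski open `U ∋ x` whose restriction
to some non-empty open `W ⊆ U` vanishes already vanishes on some open `V` with `x ∈ V ⊆ U`. Only this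
first-term exactness of (4.2.2) is vendored.
[cite: BlochOgus1974ENS, Thm. 4.2 (4.2.2) and Example (2.3)] [cite: ColliotTheleneVoisin2012, Thm. 2.3] -/
def BlochOgus1974_blochOgusSheaf_injective : Prop :=
  ∀ (A : Type) [CommRing A] (X : SchemeOver ℂ) [Smooth X.hom] [IsSeparated X.hom]
    [QuasiCompact X.hom] [IrreducibleSpace X.left] (q : ℕ) ⦃U W : X.left.Opens⦄ (hWU : W ≤ U),
    (W : Set X.left).Nonempty →
    ∀ α : (bettiZariskiPresheaf A X q).obj (op U),
      (bettiZariskiPresheaf A X q).map (homOfLE hWU).op α = 0 →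
      ∀ x ∈ U, ∃ (V : X.left.Opens) (hVU : V ≤ U), x ∈ V ∧
        (bettiZariskiPresheaf A X q).map (homOfLE hVU).op α = 0

-- TODO(general form): exactness of the whole arithmetic resolution (Bloch–Ogus 1974, (4.2.2)),
-- for any Poincaré duality theory with supports over a perfect field; only its first map is here.

/-- **Hard half of the comparison**, granted Bloch–Ogus injectivity: on a smooth irreducible `X`
(separated, of finite type over `ℂ`), `N¹ H^q(X(ℂ); A) ≤ ker (H^q(X(ℂ); A) → H^q_nr(X, A))` — a class
dying on the non-empty open `X ∖ Z` dies Zariski-locally everywhere (Bloch–Ogus 1974, (3.8)–(3.9)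
with Cor. 6.3: `N¹` is the kernel of the edge map to `E₂^{0,q} = H⁰(X, 𝓗^q)`).
[cite: BlochOgus1974ENS, (3.8) and Cor. 6.3] -/
theorem coniveauFiltration_one_le_ker_unramifiedClass (hBO : BlochOgus1974_blochOgusSheaf_injective)
    [Smooth X.hom] [IsSeparated X.hom] [QuasiCompact X.hom] [IrreducibleSpace X.left] :
    coniveauFiltration A X q 1 ≤ LinearMap.ker (unramifiedClass A X q).hom := by
  refine iSup_le fun Z ↦ iSup_le fun hZ ↦ iSup_le fun h1 z hz ↦ ?_
  rw [LinearMap.mem_ker] at hz ⊢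
  change unramifiedClass A X q z = 0
  rw [unramifiedClass_eq_zero_iff]
  intro x
  let W : X.left.Opens := ⟨Zᶜ, hZ.isOpen_compl⟩
  have hWne : (W : Set X.left).Nonempty :=
    ⟨genericPoint X.left, genericPoint_notMem_of_forall_one_le_coheight h1⟩
  have hαW : (bettiZariskiPresheaf A X q).map (homOfLE (le_top : W ≤ ⊤)).op
      (restrictToOpen A X q ⊤ z) = 0 := by
    have hsub : Z ⊆ ((W : Set X.left))ᶜ := fun y hy hy' ↦ hy' hy
    rw [map_restrictToOpen_apply]
    exact restrictToCompl_eq_zero_of_subset A X q hsub hz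
  obtain ⟨V, _, hxV, hVz⟩ :=
    hBO A X q (le_top : W ≤ ⊤) hWne (restrictToOpen A X q ⊤ z) hαW x trivial
  exact ⟨V, hxV, by rwa [map_restrictToOpen_apply] at hVz⟩

/-- **The comparison `N¹ H^q(X(ℂ); A) = ker (H^q(X(ℂ); A) → H^q_nr(X, A))`** for `X` smooth,
separated, of finite type and irreducible over `ℂ`, granted Bloch–Ogus injectivity: the unramified
class of `z` vanishes iff `z` has coniveau `≥ 1` (Bloch–Ogus 1974, (3.8) with Cor. 6.3; the
`E_∞^{0,q} ⊆ E₂^{0,q} = H⁰(X, 𝓗^q)` edge of the coniveau spectral sequence).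
[cite: BlochOgus1974ENS, (3.8) and Cor. 6.3] -/
theorem coniveauFiltration_one_eq_ker_unramifiedClass (hBO : BlochOgus1974_blochOgusSheaf_injective)
    [Smooth X.hom] [IsSeparated X.hom] [QuasiCompact X.hom] [IrreducibleSpace X.left] :
    coniveauFiltration A X q 1 = LinearMap.ker (unramifiedClass A X q).hom :=
  le_antisymm (coniveauFiltration_one_le_ker_unramifiedClass A X q hBO)
    (ker_unramifiedClass_le_coniveauFiltration_one A X q)

/-- Route-facing unfolding of the comparison: for `X` smooth, separated, of finite type and
irreducible over `ℂ` (granted Bloch–Ogus injectivity), the unramified class of `z ∈ H^q(X(ℂ); A)`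
vanishes iff `z` dies on the complex points of some non-empty Zariski open, i.e. iff there is a
Zariski-closed `Z ≠ X` with `z|_{(X ∖ Z)(ℂ)} = 0`. [cite: BlochOgus1974ENS, (3.8) and Cor. 6.3] -/
theorem unramifiedClass_eq_zero_iff_exists (hBO : BlochOgus1974_blochOgusSheaf_injective)
    [Smooth X.hom] [IsSeparated X.hom] [QuasiCompact X.hom] [IrreducibleSpace X.left]
    (z : singularCohomology A A (ComplexPoints X) q) :
    unramifiedClass A X q z = 0 ↔
      ∃ Z : Set X.left, IsClosed Z ∧ Z ≠ Set.univ ∧ restrictToCompl A X q Z z = 0 := by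
  have h : unramifiedClass A X q z = 0 ↔ z ∈ coniveauFiltration A X q 1 := by
    rw [coniveauFiltration_one_eq_ker_unramifiedClass A X q hBO, LinearMap.mem_ker]
  rw [h, mem_coniveauFiltration_iff_exists]
  exact ⟨fun ⟨Z, hZ, hr, h0⟩ ↦ ⟨Z, hZ, (forall_one_le_coheight_iff_ne_univ hZ).1 hr, h0⟩,
    fun ⟨Z, hZ, hne, h0⟩ ↦ ⟨Z, hZ, (forall_one_le_coheight_iff_ne_univ hZ).2 hne, h0⟩⟩

/-! ### Specialisation to smooth projective varieties (the shape of the route statements) -/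

variable {X} in
/-- A smooth projective variety over `ℂ` is smooth, separated, of finite type and irreducible (the
tree's `IsSmoothProjective.isProper_holds`, `isIntegral_holds`), so the comparison applies:
`N¹ H^q(X(ℂ); A) = ker (H^q(X(ℂ); A) → H^q_nr(X, A))`, granted Bloch–Ogus injectivity.
[cite: BlochOgus1974ENS, (3.8) and Cor. 6.3] -/
theorem coniveauFiltration_one_eq_ker_unramifiedClass_of_isSmoothProjective
    (hBO : BlochOgus1974_blochOgusSheaf_injective) {n : ℕ} (hX : IsSmoothProjective n X) :
    coniveauFiltration A X q 1 = LinearMap.ker (unramifiedClass A X q).hom := by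
  haveI := hX.smoothOfRelativeDimension
  haveI : Smooth X.hom := SmoothOfRelativeDimension.smooth n X.hom
  haveI : IsProper X.hom := IsSmoothProjective.isProper_holds hX
  haveI : IsIntegral X.left := IsSmoothProjective.isIntegral_holds hX
  exact coniveauFiltration_one_eq_ker_unramifiedClass A X q hBO

variable {X} in
/-- For a smooth projective variety `X` over `ℂ` (granted Bloch–Ogus injectivity), the unramified
class of `z ∈ H^q(X(ℂ); A)` vanishes iff there is a Zariski-closed `Z ≠ X` with `z|_{(X ∖ Z)(ℂ)} = 0`
— the `∃ Z, IsClosed Z ∧ Z ≠ Set.univ ∧ …` shape of the route statements over `complexPointsCompl`.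
[cite: BlochOgus1974ENS, (3.8) and Cor. 6.3] -/
theorem unramifiedClass_eq_zero_iff_exists_of_isSmoothProjective
    (hBO : BlochOgus1974_blochOgusSheaf_injective) {n : ℕ} (hX : IsSmoothProjective n X)
    (z : singularCohomology A A (ComplexPoints X) q) :
    unramifiedClass A X q z = 0 ↔
      ∃ Z : Set X.left, IsClosed Z ∧ Z ≠ Set.univ ∧ restrictToCompl A X q Z z = 0 := by
  haveI := hX.smoothOfRelativeDimension
  haveI : Smooth X.hom := SmoothOfRelativeDimension.smooth n X.hom
  haveI : IsProper X.hom := IsSmoothProjective.isProper_holds hX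
  haveI : IsIntegral X.left := IsSmoothProjective.isIntegral_holds hX
  exact unramifiedClass_eq_zero_iff_exists A X q hBO z

end Literature.AlgebraicGeometry.Motives

end
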